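import Literature.MathematicalPhysics.KineticTheory.HardSphereEuler
import Mathlib.MeasureTheory.Integral.Bochner.ContinuousLinearMap
import HarnessLib

/-!
# Quantitative Maxwellian rigidity by compactness — B: own parameters of Dirac and Maxwellian measures

Helper for the line `Sketch` of the crux `InformationPercolationEngine.ChaosClosesEuler`
(stmt-AtomisticToContinuum-15141), registered stub `stub_quantitativeRigidity`.

Elementary bookkeeping on `V3 = ℝ³` for the "own parameters" of a finite measure `m`,
mass `ρ(m) = m(ℝ³)`, bulk velocity `u(m) = ρ(m)⁻¹ ∫ v dm` and temperature
`θ(m) = (2/3) (∫ |v|²/2 dm / ρ(m) − |∫ v dm|² / (2 ρ(m)²))`: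

* `integrable_id_of_sq`, `integral_apply_coord`, `integral_id_eq_smul`, `tendsto_of_forall_coord_tendsto`,
  `tendsto_integral_id` — the vector-valued first moment `∫ v dm` through its coordinates;
* `dirac_moments`, `ownTemperature_dirac` — a point mass `c • δ_u` has own temperature `0`;
* `ownParams_of_moments` — a measure with mass `ρ > 0`, momentum `ρ u` and energy `ρ(|u|² + 3θ)`
  (the Maxwellian `M_{ρ,θ,u}`) has own temperature `θ` and own velocity `u`.

References: C. Cercignani, R. Illner, M. Pulvirenti, *The Mathematical Theory of Dilute Gases* (1994), §3.2.
-/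

noncomputable section

namespace Summit.AtomisticToContinuum.HydrodynamicLimit.Theorems.ChaosClosesEulerQuantitativeRigidity

open scoped BigOperators Topology Classical MeasureTheory ENNReal NNReal
open Filter Set MeasureTheory
open Literature.MathematicalPhysics.KineticTheory

/-! ## The vector-valued first moment -/

/-- On a finite measure, `|v|²` integrable makes `v ↦ v` integrable (`|v| ≤ 1 + |v|²`). [folklore] -/
theorem integrable_id_of_sq {m : Measure V3} [IsFiniteMeasure m]
    (h2 : Integrable (fun v : V3 => ‖v‖ ^ 2) m) : Integrable (fun v : V3 => v) m :=
  ((integrable_const (1 : ℝ)).add h2).mono' (by fun_prop : Continuous fun v : V3 => v).aestronglyMeasurable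
    (Eventually.of_forall fun v =>
      (show ‖v‖ ≤ 1 + ‖v‖ ^ 2 by nlinarith [norm_nonneg v, sq_nonneg (‖v‖ - 1)]))

/-- Coordinates of the vector integral: `(∫ v dm)_j = ∫ v_j dm`. [folklore] -/
theorem integral_apply_coord {m : Measure V3} (hint : Integrable (fun v : V3 => v) m) (j : Fin 3) :
    (∫ v, v ∂m) j = ∫ v, v j ∂m := by
  have h := ((EuclideanSpace.proj j : V3 →L[ℝ] ℝ).integral_comp_comm hint).symm
  simpa using h

/-- If every coordinate moment is `ρ u_j`, the vector first moment is `ρ • u`. [folklore] -/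
theorem integral_id_eq_smul {m : Measure V3} (hint : Integrable (fun v : V3 => v) m) {ρ : ℝ} {u : V3}
    (h : ∀ j : Fin 3, ∫ v, v j ∂m = ρ * u j) : ∫ v, v ∂m = ρ • u := by
  ext j
  rw [integral_apply_coord hint, h j, PiLp.smul_apply, smul_eq_mul]

/-- Convergence in `ℝ³` is coordinatewise convergence. [folklore] -/
theorem tendsto_of_forall_coord_tendsto {ι : Type*} {l : Filter ι} {f : ι → V3} {a : V3}
    (h : ∀ j : Fin 3, Tendsto (fun i => f i j) l (𝓝 (a j))) : Tendsto f l (𝓝 a) := by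
  have h1 : Tendsto (fun i => WithLp.ofLp (f i)) l (𝓝 (WithLp.ofLp a)) := tendsto_pi_nhds.2 h
  have h2 := ((PiLp.continuous_toLp 2 (fun _ : Fin 3 => ℝ)).tendsto (WithLp.ofLp a)).comp h1
  rw [WithLp.toLp_ofLp] at h2
  exact h2.congr fun i => WithLp.toLp_ofLp 2 (f i)

/-- Convergence of the coordinate first moments gives convergence of the vector first moment. [folklore] -/
theorem tendsto_integral_id {μs : ℕ → Measure V3} {μ : Measure V3}
    (hi : ∀ n, Integrable (fun v : V3 => v) (μs n)) (hμ : Integrable (fun v : V3 => v) μ)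
    (h : ∀ j : Fin 3, Tendsto (fun n => ∫ v, v j ∂(μs n)) atTop (𝓝 (∫ v, v j ∂μ))) :
    Tendsto (fun n => ∫ v, v ∂(μs n)) atTop (𝓝 (∫ v, v ∂μ)) := by
  refine tendsto_of_forall_coord_tendsto fun j => ?_
  have e1 : ∀ n, (∫ v, v ∂(μs n)) j = ∫ v, v j ∂(μs n) := fun n => integral_apply_coord (hi n) j
  simp only [e1, integral_apply_coord hμ]
  exact h j

/-! ## Point masses have zero own temperature -/

/-- Mass, momentum and kinetic energy of the point mass `c • δ_u`. [folklore] -/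
theorem dirac_moments (c : ℝ≥0∞) (u : V3) :
    ((c • Measure.dirac u : Measure V3) univ).toReal = c.toReal ∧
    ∫ v, v ∂(c • Measure.dirac u : Measure V3) = c.toReal • u ∧
    ∫ v, ‖v‖ ^ 2 / 2 ∂(c • Measure.dirac u : Measure V3) = c.toReal * (‖u‖ ^ 2 / 2) := by
  refine ⟨?_, ?_, ?_⟩
  · rw [Measure.smul_apply, smul_eq_mul, measure_univ, mul_one]
  · rw [integral_smul_measure, integral_dirac]
  · rw [integral_smul_measure, integral_dirac, smul_eq_mul]

/-- **A point mass has own temperature zero**: for `m = c • δ_u`,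
`(2/3) (∫ |v|²/2 dm / m(ℝ³) − |∫ v dm|² / (2 m(ℝ³)²)) = 0`. [folklore] -/
theorem ownTemperature_dirac (c : ℝ≥0∞) (u : V3) :
    2 / 3 * ((∫ v, ‖v‖ ^ 2 / 2 ∂(c • Measure.dirac u : Measure V3)) /
        ((c • Measure.dirac u : Measure V3) univ).toReal -
      ‖∫ v, v ∂(c • Measure.dirac u : Measure V3)‖ ^ 2 /
        (2 * ((c • Measure.dirac u : Measure V3) univ).toReal ^ 2)) = 0 := by
  obtain ⟨h1, h2, h3⟩ := dirac_moments c u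
  rw [h1, h2, h3, norm_smul, Real.norm_eq_abs, abs_of_nonneg ENNReal.toReal_nonneg]
  rcases eq_or_ne c.toReal 0 with hc | hc
  · rw [hc]
    simp
  · field_simp
    ring

/-! ## Own parameters of a Maxwellian from its moments -/

/-- **Own parameters from Maxwellian moments**: if `m` has mass `ρ > 0`, momentum `∫ v dm = ρ u` and
energy `∫ |v|² dm = ρ (|u|² + 3θ)`, then its own temperature is `θ` and its own velocity is `u`. [folklore] -/
theorem ownParams_of_moments {m : Measure V3} {ρ θ : ℝ} {u : V3} (hρ : 0 < ρ)
    (hmass : (m univ).toReal = ρ) (hP : ∫ v, v ∂m = ρ • u)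
    (hE : ∫ v, ‖v‖ ^ 2 ∂m = ρ * (‖u‖ ^ 2 + 3 * θ)) :
    2 / 3 * ((∫ v, ‖v‖ ^ 2 / 2 ∂m) / (m univ).toReal - ‖∫ v, v ∂m‖ ^ 2 / (2 * (m univ).toReal ^ 2)) = θ ∧
      ((m univ).toReal)⁻¹ • ∫ v, v ∂m = u := by
  rw [integral_div, hE, hmass, hP, norm_smul, Real.norm_eq_abs, abs_of_pos hρ, smul_smul,
    inv_mul_cancel₀ hρ.ne', one_smul]
  refine ⟨?_, rfl⟩
  field_simp
  ring

/-! ## Registered sub-goal -/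

/-- **Registered sub-goal `stub_quantitativeRigidityB` (helper B of `stub_quantitativeRigidity`): a point mass
`c • δ_u` has own temperature `0`.** [folklore] -/
theorem stub_quantitativeRigidityB : ∀ (c : ℝ≥0∞) (u : V3), 2 / 3 * ((∫ v, ‖v‖ ^ 2 / 2 ∂(c • Measure.dirac u : Measure V3)) / ((c • Measure.dirac u : Measure V3) Set.univ).toReal - ‖∫ v, v ∂(c • Measure.dirac u : Measure V3)‖ ^ 2 / (2 * ((c • Measure.dirac u : Measure V3) Set.univ).toReal ^ 2)) = 0 :=
  ownTemperature_dirac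

end Summit.AtomisticToContinuum.HydrodynamicLimit.Theorems.ChaosClosesEulerQuantitativeRigidity

end
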